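/-
Copyright: the b2b-balaban T⁴-continuum CRUX team, row NE7b owner lineage `t4-ne7b-p1` (gen 115). Project licence.
-/
import Summits.QuantumFields.BalabanUV.T4Continuum.Spine.NE7b.AugmentedSupEquivalence
import Summits.QuantumFields.BalabanUV.T4Continuum.Spine.NE7b.OneShotChartTorusRowsZd

/-!
# THE SUP CHART RESTRICTS TO EVERY TORUS: ASE's augmented equivalence `T h = (Q′h, P(Ah))` of the Gaussian skeleton on `ℤ^d` and its
# displayed inverse `T⁻¹(w, κ) = Hw + Γκ` PRESERVE PERIODICITY — a fine field of period `side·s` (any coarse period `s ≥ 1`) has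
# `s`-periodic block means and a `side·s`-periodic fibre component, and `T⁻¹` of an `s`-periodic coarse field and a `side·s`-periodic fibre
# datum is `side·s`-periodic — so the chart, its constant `N_∞` and every sup ∕ weighted letter of (46)–(71) hold verbatim on the torus
# `(ℤ∕side·s ℤ)^d` by restriction: the torus twin of ASE without a torus-side minimiser
# (row NE7b, node U5c; ASE + (55)'s block-translation covariance BY NAME; the OWNER g114's HANDOFF-FINAL item (ii); [folklore])

Cell `pub-balaban`, sub-cell `t4`, spine estimate NE7b (`T4WeightBudget.RelWeightBound`; the cell's OWN estimate — NOT PRINTED in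
[Bałaban 1983–89], NOT PROVED).  Crux-route work under `Spine/NE7b/` by the row OWNER (`t4-ne7b-p1` gen 115) under FREEZE (0)'s
crux-prover clause (FILING-CLAIM C-ne7bp1-g115-11); NOTHING of Bałaban's is named, valued or asserted; no `def`, no notation; zero
`sorry`.  Imports (BY NAME): leaf-06's ASE `…AugmentedSupEquivalence` (`exists_aug_equiv_sup` with the displayed actions and inverse) and
the owner's (55) `…OneShotChartTorusRowsZd` (`HBZd_translate`, `Gk_translate`, `AX_translate`, `sum_B_translate`, `blk_translate`;
through it `B5Hk103ScalarZd.tsum_AX_mul`).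

WHY (located).  The measures and the hard-step cell's charts live on tori; (55) identified the periodised section, (68) localised it.
What makes the WHOLE sup road a torus statement is simpler than a torus-side construction: every operator of the skeleton is
block-translation covariant ((55) §1), so each maps periodic fields to periodic fields, and ASE's `T` — a bijection of `ℓ^∞` — restricts
to a bijection between the closed subspaces of periodic fields (surjectivity onto periodic data: `T⁻¹` of periodic data is periodic, by
the displayed formula).  Periodic fields ARE the torus fields, with the same sup norm.  This file proves the five periodicity facts at
the level of the displayed actions and re-exports ASE with them.

WHAT IS PROVED ([folklore]; every `d` unless marked; `s : ℕ` the coarse period, fine period `side n • (s • t)`; a coarse field `w` is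
`s`-periodic if `w(y + s•t) = w(y)`, a fine field `f` is periodic if `f(q + side•(s•t)) = f(q)`, for all `t ∈ ℤ^d`):
* §1 `HBZd_periodic` (the section of a periodic coarse field is periodic), `tsum_Gk_mul_periodic` (`G′` of a periodic fine field),
  `blockAvg_periodic` (`Q′` of a periodic fine field is `s`-periodic), `fibreProj_periodic` (`P`), `sum_AX_periodic` (`A`),
  **`fibreInverse_periodic`** (the displayed `Γκ`), **`augInverse_periodic`** (the displayed `T⁻¹(w,κ) = Hw + Γκ`).
* §2 **`exists_aug_equiv_sup_periodic`** (`d ≥ 3`): ASE's `exists_aug_equiv_sup` RE-EXPORTED (same displayed actions, `‖Q′‖ ≤ 1`,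
  `‖P‖ ≤ 2`, `Rop = P∘A` into `ker Q′`, `T h = (Q′h, Rop h)`, `T⁻¹` displayed, `‖T⁻¹y‖ ≤ N_∞‖y‖`) PLUS, for every period `s`: `h` periodic
  ⟹ `Q′h` `s`-periodic ∧ `Rop h` periodic; `w` `s`-periodic ∧ `κ` periodic ⟹ `T⁻¹(w,κ)` periodic — THE CHART IS A BIJECTION BETWEEN THE
  PERIODIC SUBSPACES, with the same constant.

HONEST (what this is NOT).  No torus-side object (no `Fintype` carrier, no identification with a torus minimiser — (55)'s caveat; the
bridge `periodic fields ≃ torus fields` is the Literature `Beta.siteOf` kit's business and is not typed here); constants existential ∕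
useless by value at small sides; scalar skeleton, not the covariant operators ((A3), NC-NE7b-α UNRULED); nothing of Bałaban's.
BY-NAME EFFECT ON THE WALL: NONE.  NE7b NOT PRINTED ∕ NOT PROVED; spine PROVED 0∕9; rung (B)+1 on a FINITE torus — NOT infinite volume,
NOT the mass gap, NOT Clay.  HONEST DEPENDENCY: continuum YM on T⁴ ⇐ BetaPertH ∧ nine spine estimates (0∕9 proved); BetaPertH ⇐
(D1) ∧ (D4) ∧ CAP+tail; G-an2-4 gates asym, D1 and NE2∕3∕4.
-/

set_option autoImplicit false

noncomputable section

namespace Summit.QuantumFields.BalabanUV.T4Continuum.NE7b.AugmentedInversePeriodic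

open scoped ENNReal
open Literature.MathematicalPhysics.QuantumFieldTheory.Balaban1983to89
open B4Sect5Proof (latticeConst)
open B6QGQLower276 (X blk B side AX c0)
open B6QGQDecay237 (deltaU)
open B5Hk103ScalarZd (Gk nbhd deltaH tsum_AX_mul)
open B5Hk165L2Zd (HBZd)
open Summit.QuantumFields.BalabanUV.Beta.D1BFx.BlockColumnSupNorm (cHs)
open Summit.QuantumFields.BalabanUV.Beta.D1BFx.PointColumnSplit (cKL cG0 cSplit)
open Summit.QuantumFields.BalabanUV.Beta.D1BFx.PointColumnDecay (cFar)
open AugmentedSupEquivalence (exists_aug_equiv_sup)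
open OneShotChartTorusRowsZd (HBZd_translate Gk_translate AX_translate sum_B_translate blk_translate)

variable {d : ℕ}

/-! ## §1. The displayed actions preserve periodicity -/

/-- **The section of an `s`-periodic coarse field is `side·s`-periodic** ((55) `HBZd_translate`). [folklore] -/
theorem HBZd_periodic (n : ℕ) {a : ℝ} (ha : 0 < a) (s : ℕ) {w : X d → ℝ} (hw : ∀ y t : X d, w (y + (s : ℤ) • t) = w y)
    (p t : X d) : HBZd n a w (p + side n • ((s : ℤ) • t)) = HBZd n a w p := by
  have hper : (fun y : X d => w (y - (s : ℤ) • t)) = w := by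
    funext y
    have h := hw (y - (s : ℤ) • t) t
    rw [sub_add_cancel] at h
    exact h.symm
  rw [← HBZd_translate n ha w ((s : ℤ) • t) p, hper]

/-- **`G′` of a periodic fine field is periodic** ((55) `Gk_translate`, reindexing the series by the translation). [folklore] -/
theorem tsum_Gk_mul_periodic (n : ℕ) {a : ℝ} (ha : 0 < a) (s : ℕ) {f : X d → ℝ}
    (hf : ∀ q t : X d, f (q + side n • ((s : ℤ) • t)) = f q) (p t : X d) :
    ∑' q : X d, Gk n a (p + side n • ((s : ℤ) • t)) q * f q = ∑' q : X d, Gk n a p q * f q := by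
  rw [← (Equiv.addRight (side n • ((s : ℤ) • t))).tsum_eq (fun q => Gk n a (p + side n • ((s : ℤ) • t)) q * f q)]
  exact tsum_congr fun q => by rw [Equiv.coe_addRight, Gk_translate n ha, hf]

/-- **The block mean of a periodic fine field is `s`-periodic** ((55) `sum_B_translate`). [folklore] -/
theorem blockAvg_periodic (n : ℕ) (s : ℕ) {f : X d → ℝ} (hf : ∀ q t : X d, f (q + side n • ((s : ℤ) • t)) = f q) (y t : X d) :
    (((n : ℝ) + 1) ^ d)⁻¹ * ∑ q ∈ B n (y + (s : ℤ) • t), f q = (((n : ℝ) + 1) ^ d)⁻¹ * ∑ q ∈ B n y, f q := by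
  rw [sum_B_translate]
  exact congrArg _ (Finset.sum_congr rfl fun q _ => hf q t)

/-- **The fibre projection of a periodic fine field is periodic**: `(Pf)(p) = f p − (Q′f)(blk p)` ((55) `blk_translate`). [folklore] -/
theorem fibreProj_periodic (n : ℕ) (s : ℕ) {f : X d → ℝ} (hf : ∀ q t : X d, f (q + side n • ((s : ℤ) • t)) = f q) (p t : X d) :
    f (p + side n • ((s : ℤ) • t)) - (((n : ℝ) + 1) ^ d)⁻¹ * ∑ q ∈ B n (blk n (p + side n • ((s : ℤ) • t))), f q
      = f p - (((n : ℝ) + 1) ^ d)⁻¹ * ∑ q ∈ B n (blk n p), f q := by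
  rw [hf, blk_translate, blockAvg_periodic n s hf]

/-- **The site operator of a periodic fine field is periodic** (`tsum_AX_mul` + (55) `AX_translate`, reindexing). [folklore] -/
theorem sum_AX_periodic (n : ℕ) (a : ℝ) (s : ℕ) {f : X d → ℝ} (hf : ∀ q t : X d, f (q + side n • ((s : ℤ) • t)) = f q)
    (p t : X d) :
    ∑ r ∈ nbhd n (p + side n • ((s : ℤ) • t)), AX n a (p + side n • ((s : ℤ) • t)) r * f r = ∑ r ∈ nbhd n p, AX n a p r * f r := by
  rw [← tsum_AX_mul, ← tsum_AX_mul,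
    ← (Equiv.addRight (side n • ((s : ℤ) • t))).tsum_eq (fun r => AX n a (p + side n • ((s : ℤ) • t)) r * f r)]
  exact tsum_congr fun r => by rw [Equiv.coe_addRight, AX_translate, hf]

/-- **THE DISPLAYED FIBRE INVERSE OF A PERIODIC FIBRE DATUM IS PERIODIC**: `(Γκ)(p) = (G′κ)(p) − (H(Q′G′κ))(p)`. [folklore] -/
theorem fibreInverse_periodic (n : ℕ) {a : ℝ} (ha : 0 < a) (s : ℕ) {κ : X d → ℝ}
    (hκ : ∀ q t : X d, κ (q + side n • ((s : ℤ) • t)) = κ q) (p t : X d) :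
    (∑' q : X d, Gk n a (p + side n • ((s : ℤ) • t)) q * κ q)
        - HBZd n a (fun y => (((n : ℝ) + 1) ^ d)⁻¹ * ∑ p' ∈ B n y, ∑' q : X d, Gk n a p' q * κ q) (p + side n • ((s : ℤ) • t))
      = (∑' q : X d, Gk n a p q * κ q)
        - HBZd n a (fun y => (((n : ℝ) + 1) ^ d)⁻¹ * ∑ p' ∈ B n y, ∑' q : X d, Gk n a p' q * κ q) p := by
  have hG : ∀ q t' : X d, (∑' q' : X d, Gk n a (q + side n • ((s : ℤ) • t')) q' * κ q') = ∑' q' : X d, Gk n a q q' * κ q' :=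
    fun q t' => tsum_Gk_mul_periodic n ha s hκ q t'
  have hQG : ∀ y t' : X d, (((n : ℝ) + 1) ^ d)⁻¹ * ∑ p' ∈ B n (y + (s : ℤ) • t'), ∑' q : X d, Gk n a p' q * κ q
      = (((n : ℝ) + 1) ^ d)⁻¹ * ∑ p' ∈ B n y, ∑' q : X d, Gk n a p' q * κ q :=
    fun y t' => blockAvg_periodic n s (f := fun p' => ∑' q : X d, Gk n a p' q * κ q) hG y t'
  rw [tsum_Gk_mul_periodic n ha s hκ p t, HBZd_periodic n ha s hQG p t]

/-- **THE DISPLAYED INVERSE OF THE AUGMENTED MAP PRESERVES PERIODICITY**: for an `s`-periodic coarse field `w` and a periodic fibre datum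
`κ`, `T⁻¹(w,κ) = Hw + Γκ` is periodic. [folklore] -/
theorem augInverse_periodic (n : ℕ) {a : ℝ} (ha : 0 < a) (s : ℕ) {w κ : X d → ℝ} (hw : ∀ y t : X d, w (y + (s : ℤ) • t) = w y)
    (hκ : ∀ q t : X d, κ (q + side n • ((s : ℤ) • t)) = κ q) (p t : X d) :
    HBZd n a w (p + side n • ((s : ℤ) • t))
        + ((∑' q : X d, Gk n a (p + side n • ((s : ℤ) • t)) q * κ q)
          - HBZd n a (fun y => (((n : ℝ) + 1) ^ d)⁻¹ * ∑ p' ∈ B n y, ∑' q : X d, Gk n a p' q * κ q) (p + side n • ((s : ℤ) • t)))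
      = HBZd n a w p
        + ((∑' q : X d, Gk n a p q * κ q)
          - HBZd n a (fun y => (((n : ℝ) + 1) ^ d)⁻¹ * ∑ p' ∈ B n y, ∑' q : X d, Gk n a p' q * κ q) p) := by
  rw [HBZd_periodic n ha s hw p t, fibreInverse_periodic n ha s hκ p t]

/-! ## §2. ASE's chart restricted to the periodic subspaces -/

/-- **ASE's EQUIVALENCE RESTRICTS TO EVERY TORUS** (`d ≥ 3`): `exists_aug_equiv_sup` re-exported with its displayed actions, norms,
`Rop`, `T`, the displayed `T⁻¹` and `‖T⁻¹y‖ ≤ N_∞‖y‖`, AND for every coarse period `s`: a periodic fine field (period `side•s`) has an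
`s`-periodic block mean and a periodic fibre component `Rop`, and `T⁻¹` of an `s`-periodic coarse field and a periodic fibre datum is
periodic — `T` is a bijection between the periodic subspaces (the torus fields), with the same constant. [folklore] -/
theorem exists_aug_equiv_sup_periodic (hd : 3 ≤ d) (n : ℕ) {a : ℝ} (ha : 0 < a) :
    ∃ (Dop Aop Pop : lp (fun _ : X d => ℝ) ∞ →L[ℝ] lp (fun _ : X d => ℝ) ∞),
      (∀ (f : lp (fun _ : X d => ℝ) ∞) (y : X d), Dop f y = (((n : ℝ) + 1) ^ d)⁻¹ * ∑ p ∈ B n y, f p) ∧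
      (∀ (f : lp (fun _ : X d => ℝ) ∞) (p : X d), Aop f p = ∑ r ∈ nbhd n p, AX n a p r * f r) ∧
      (∀ (f : lp (fun _ : X d => ℝ) ∞) (p : X d), Pop f p = f p - (((n : ℝ) + 1) ^ d)⁻¹ * ∑ p' ∈ B n (blk n p), f p') ∧
      ‖Dop‖ ≤ 1 ∧ ‖Pop‖ ≤ 2 ∧
      ∃ Rop : lp (fun _ : X d => ℝ) ∞ →L[ℝ] Dop.ker,
        (∀ h, (Rop h : lp (fun _ : X d => ℝ) ∞) = Pop (Aop h)) ∧
        ∃ T : lp (fun _ : X d => ℝ) ∞ ≃L[ℝ] (lp (fun _ : X d => ℝ) ∞) × Dop.ker,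
          (∀ h, T h = (Dop h, Rop h)) ∧
          (∀ (w : lp (fun _ : X d => ℝ) ∞) (κ : Dop.ker) (p : X d),
            (T.symm (w, κ) : lp (fun _ : X d => ℝ) ∞) p
              = HBZd n a w p
                + ((∑' q : X d, Gk n a p q * (κ : lp (fun _ : X d => ℝ) ∞) q)
                  - HBZd n a (fun y => (((n : ℝ) + 1) ^ d)⁻¹ * ∑ p' ∈ B n y,
                      ∑' q : X d, Gk n a p' q * (κ : lp (fun _ : X d => ℝ) ∞) q) p)) ∧
          (∀ y, ‖T.symm y‖
            ≤ (cHs d a * latticeConst d (deltaH d a)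
                + ((cG0 d * cKL d (d - 2) + cSplit d a) * Real.exp (2 * deltaU d a)
                    + cFar d a * Real.exp (4 * deltaU d a) / deltaU d a ^ 2) * latticeConst d (deltaU d a / 4)
                  * (1 + cHs d a * latticeConst d (deltaH d a))) * ‖y‖) ∧
          ∀ s : ℕ,
            (∀ h : lp (fun _ : X d => ℝ) ∞, (∀ q t : X d, h (q + side n • ((s : ℤ) • t)) = h q) →
              (∀ y t : X d, Dop h (y + (s : ℤ) • t) = Dop h y) ∧
              (∀ q t : X d, (Rop h : lp (fun _ : X d => ℝ) ∞) (q + side n • ((s : ℤ) • t)) = (Rop h : lp (fun _ : X d => ℝ) ∞) q)) ∧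
            (∀ (w : lp (fun _ : X d => ℝ) ∞) (κ : Dop.ker), (∀ y t : X d, w (y + (s : ℤ) • t) = w y) →
              (∀ q t : X d, (κ : lp (fun _ : X d => ℝ) ∞) (q + side n • ((s : ℤ) • t)) = (κ : lp (fun _ : X d => ℝ) ∞) q) →
              ∀ p t : X d, (T.symm (w, κ) : lp (fun _ : X d => ℝ) ∞) (p + side n • ((s : ℤ) • t))
                = (T.symm (w, κ) : lp (fun _ : X d => ℝ) ∞) p) := by
  obtain ⟨Dop, Aop, Pop, hD, hA, hP, hDn, hPn, Rop, hRapp, T, hT, hTsymm, hTN⟩ := exists_aug_equiv_sup hd n ha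
  refine ⟨Dop, Aop, Pop, hD, hA, hP, hDn, hPn, Rop, hRapp, T, hT, hTsymm, hTN, fun s => ⟨fun h hh => ⟨fun y t => ?_, fun q t => ?_⟩,
    fun w κ hw hκ p t => ?_⟩⟩
  · rw [hD, hD]; exact blockAvg_periodic n s hh y t
  · have hAh : ∀ q' t' : X d, Aop h (q' + side n • ((s : ℤ) • t')) = Aop h q' := fun q' t' => by
      rw [hA, hA]; exact sum_AX_periodic n a s hh q' t'
    rw [hRapp, hP, hP]; exact fibreProj_periodic n s hAh q t
  · rw [hTsymm, hTsymm]; exact augInverse_periodic n ha s hw hκ p t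

end Summit.QuantumFields.BalabanUV.T4Continuum.NE7b.AugmentedInversePeriodic

end
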